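import Literature.NumberTheory.EllipticCurves.QuarticTwistThetaDictionary
import Literature.NumberTheory.QuadraticFields.GaussianQuarticCharMod
import HarnessLib

/-!
# The `q`-part of the theta coefficient of `y² = x³ − Dx` at an inert prime `q ≡ 3 (4)`: `Ψ_D = \overline{(·/q)₄}^k · Ψ'`

Topic `Literature/NumberTheory/EllipticCurves`, namespace `Literature.NumberTheory.EllipticCurves.QuarticTwist` (continuing
`QuarticTwistThetaDictionary.lean`).  Theorems only (no definition, no named fact).

`QuarticTwistThetaDictionary.thetaWeight_three_split` separates the prime `3` from the theta coefficient
`Ψ_D(x) = 𝟙[(N x, D) = 1] · \overline{(D/x)₄} · e(u(x)) · c(N x)` of the quartic twist `E_D : y² = x³ − Dx` when `D = (-3)^k D₁`: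
`Ψ_D = \overline{(·/3)₄}^k · Ψ'`, with `Ψ'` the coefficient for `D₁` and unit weight `e(u) = \overline{(u/3)₄}^k u`.  The only input
special to `3` there is the reciprocity step `(-3/x̃)₄ = (x̃/3)₄` (Ireland–Rosen Prop. 9.9.8 with `a = -3 ≡ 1 (4)`).  The same holds at
EVERY rational prime `q ≡ 3 (4)` (inert in `ℤ[i]`; `-q ≡ 1 (4)` is primary): with the quartic residue character
`(·/q)₄ = quarticCharMod q` of `ℤ[i]/q = 𝔽_{q²}` (`QuadraticFields/GaussianQuarticCharMod`, `quarticSymbolInt_neg_natCast_pow_mul_of_isPrimary`: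
`((-q)^k D₁/x̃)₄ = (x̃/q)₄^k (D₁/x̃)₄`),

* `thetaWeight_inert_split` — for `D = (-q)^k D₁`, `k ≥ 1`: **`Ψ_D(x) = \overline{(x/q)₄}^k · Ψ'(x)`**, `Ψ'` the coefficient for `D₁`
  with unit weight `e(u) = \overline{(u/q)₄}^k u`; for `q ∣ x` both sides vanish;
* (the case `q = 3` is literally the landed `thetaWeight_three_split`, through `quarticCharMod_three : quarticCharMod 3 = quarticCharThree`;
  not restated here);
* `lSeries_twist_eq_thetaLFunction_inert` — **Theorem 18.7 for `E_A : y² = x³ + Ax`, `q ∣ A`, at level `q · M'` with the `q`-character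
  split off**: `Σ_n c(n) a_n(E_A) n⁻ˢ = ¼ · Θ-L_{qM'}(\overline{(·/q)₄}^{v_q(A)} · Ψ)(s)` for `re s > 3/2`, `M'` prime to `q`, `Ψ` periodic
  modulo `M'` with algebraic-integer values (the level-`8|A|m` identity `lSeries_twist_eq_thetaLFunction` re-levelled by absolute convergence).

This is the dictionary step by which the prime `q` of an additive fibre of `E_D` at `q ∣ D` (Kodaira `III`, `I₀*`, `III*` for
`v_q(D) = 1, 2, 3`) enters the weight-one theta series of `ℤ[i]` as a character modulo `q`, uniformly in `q` (used at `q = 3` by the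
`j = 1728` cell of the BSD programme's inert-bad analysis, and at `q = 7` by its supercuspidal twin).

## References
* K. Ireland, M. Rosen, *A Classical Introduction to Modern Number Theory*, 2nd ed., GTM 84 (1990), Ch. 18 §6 Theorem 7 (proof);
  Ch. 9 §8 Props. 9.8.2–9.8.4, §9 Prop. 9.9.8. [IrelandRosen1990] [IrelandRosen1982]
* N. Koblitz, *Introduction to Elliptic Curves and Modular Forms*, GTM 97 (1993), Ch. II §5 (theta continuation). [KoblitzECMF1993]

## Mathlib / tree search
Tree: `QuarticTwist.thetaWeight_three_split` (the `q = 3` case, whose proof is followed line by line), `three_dvd_norm_iff`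
(`EllipticCurves/QuarticTwistThetaDictionary`); `quarticCharMod`, `quarticCharMod_mul`, `quarticCharMod_natCast_eq_zero_iff`,
`natCast_dvd_norm_iff`, `quarticSymbolInt_neg_natCast_pow_mul_of_isPrimary`, `quarticCharMod_three` (`QuadraticFields/GaussianQuarticCharMod`);
`quarticSymbolInt_primary`, `primaryUnit`, `primary_eq_primaryUnit_mul`, `exists_isUnit_primary_eq`, `isPrimary_primary`,
`primaryUnit_eq_zero_of_even` (`GaussianQuarticSymbol`, `CongruentNumberCurveHeckeSeries`).  Mathlib: `Nat.Prime.coprime_iff_not_dvd`,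
`Int.isCoprime_iff_gcd_eq_one`, `IsCoprime.pow_right`.
-/

noncomputable section

open scoped Classical ComplexConjugate

namespace Literature.NumberTheory.EllipticCurves

namespace QuarticTwist

open WeierstrassCurve Complex
open Literature.NumberTheory.QuadraticFields.GaussianPrimary Literature.NumberTheory.QuadraticFields.GaussianQuarticSymbol
open Literature.NumberTheory.EllipticCurves.GaussianPrimary Literature.NumberTheory.LFunctions

variable {D : ℤ} {m : ℕ}

/-- **The `q`-part of the theta coefficient at an inert prime `q ≡ 3 (4)`.**  For `D = (-q)^k · D₁` with `k ≥ 1` and any `c`: the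
coefficient `Ψ_D` (unit weight `id`) factors as `Ψ_D(x) = \overline{(x/q)₄}^k · Ψ'(x)`, where `Ψ'` is the coefficient for `D₁` with unit
weight `e(u) = \overline{(u/q)₄}^k u` (`(D/x̃)₄ = (x̃/q)₄^k (D₁/x̃)₄` by Prop. 9.9.8 for `a = -q`, and `(x̃/q)₄ = (u/q)₄ (x/q)₄` for `x̃ = u x`;
for `q ∣ x` both sides vanish).  The case `q = 3` is `thetaWeight_three_split`.
[cite: IrelandRosen1990, Ch. 9 §9, Prop. 9.9.8; Ch. 18 §6, Theorem 7] -/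
theorem thetaWeight_inert_split {q : ℕ} (hq : q.Prime) (hq3 : q % 4 = 3) {k : ℕ} (hk : k ≠ 0) (D₁ : ℤ)
    (hD : D = (-(q : ℤ)) ^ k * D₁) (c : ZMod m → ℂ) {Ψ Ψ' : GaussianInt → ℂ}
    (hΨ : ∀ x, Ψ x = (if IsCoprime x.norm D then ((star (quarticSymbolInt D x) * primaryUnit x : GaussianInt) : ℂ) else 0) *
      c (x.norm : ZMod m))
    (hΨ' : ∀ x, Ψ' x = (if IsCoprime x.norm D₁ then
      ((star (quarticSymbolInt D₁ x) * (star (quarticCharMod q (primaryUnit x)) ^ k * primaryUnit x) : GaussianInt) : ℂ) else 0) *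
      c (x.norm : ZMod m))
    (x : GaussianInt) : Ψ x = ((star (quarticCharMod q x) : GaussianInt) : ℂ) ^ k * Ψ' x := by
  rw [hΨ, hΨ']
  by_cases hqx : (q : GaussianInt) ∣ x
  · -- both sides vanish
    have hq0 : quarticCharMod q x = 0 := (quarticCharMod_natCast_eq_zero_iff hq hq3 x).mpr hqx
    have hncop : ¬ IsCoprime x.norm D := by
      intro h
      rw [hD] at h
      have h' : IsCoprime x.norm (q : ℤ) :=
        (IsCoprime.neg_right_iff _ _).mp ((IsCoprime.pow_right_iff (Nat.pos_of_ne_zero hk)).mp h.of_mul_right_left)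
      have hqq : IsCoprime (q : ℤ) q := h'.of_isCoprime_of_dvd_left ((natCast_dvd_norm_iff hq hq3 x).mpr hqx)
      have := Int.isCoprime_iff_gcd_eq_one.mp hqq
      rw [Int.gcd_self, Int.natAbs_natCast] at this
      exact hq.one_lt.ne' this
    rw [if_neg hncop, hq0, star_zero, map_zero, zero_pow hk, zero_mul, zero_mul]
  · have hqn : ¬ (q : ℤ) ∣ x.norm := fun h ↦ hqx ((natCast_dvd_norm_iff hq hq3 x).mp h)
    have hcopq : IsCoprime x.norm ((-(q : ℤ)) ^ k) :=
      IsCoprime.pow_right (((Nat.prime_iff_prime_int.mp hq).coprime_iff_not_dvd.mpr hqn).symm.neg_right)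
    have hiff : IsCoprime x.norm D ↔ IsCoprime x.norm D₁ := by
      rw [hD]; exact ⟨fun h ↦ h.of_mul_right_right, fun h ↦ IsCoprime.mul_right hcopq h⟩
    by_cases hcop : IsCoprime x.norm D
    · rw [if_pos hcop, if_pos (hiff.mp hcop)]
      by_cases hodd : (x.re + x.im) % 2 = 1
      · have hprim : IsPrimary (primary x) := isPrimary_primary hodd
        have hux' : primary x = primaryUnit x * x := primary_eq_primaryUnit_mul x
        -- `(D/x)₄ = (D/x̃)₄ = (x̃/q)₄^k (D₁/x̃)₄ = ((u/q)₄ (x/q)₄)^k (D₁/x)₄`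
        have key : quarticSymbolInt D x =
            (quarticCharMod q (primaryUnit x) * quarticCharMod q x) ^ k * quarticSymbolInt D₁ x := by
          rw [← quarticSymbolInt_primary D hodd, hD, quarticSymbolInt_neg_natCast_pow_mul_of_isPrimary hq hq3 k D₁ hprim,
            quarticSymbolInt_primary D₁ hodd, hux', quarticCharMod_mul]
        rw [key, star_mul, star_pow, star_mul, mul_pow]
        simp only [map_mul, map_pow]
        ring
      · rw [primaryUnit_eq_zero_of_even (by omega)]
        simp
    · simp only [if_neg hcop, if_neg (fun h ↦ hcop (hiff.mpr h)), zero_mul, mul_zero]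

/-! ### §2 The model dictionary at level `q · M'`: `Σ c(n) a_n(E_A) n⁻ˢ = ¼ · Θ-L_{qM'}(\overline{(·/q)₄}^{v_q(A)} · Ψ)` -/

/-- `−A = (−q)^{v_q(A)} · D₁` with `D₁ ≠ 0` and `q ∤ D₁`, for `A ≠ 0` and a prime `q` (plumbing). [folklore] -/
private theorem exists_neg_eq_neg_pow_mul {q : ℕ} (hq : q.Prime) {A : ℤ} (hA : A ≠ 0) :
    ∃ D₁ : ℤ, D₁ ≠ 0 ∧ ¬ (q : ℤ) ∣ D₁ ∧ -A = (-(q : ℤ)) ^ (padicValInt q A) * D₁ := by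
  haveI : Fact q.Prime := ⟨hq⟩
  set k : ℕ := padicValInt q A with hk
  obtain ⟨B, hB⟩ : (q : ℤ) ^ k ∣ A := (padicValInt_dvd_iff _ A).mpr (Or.inr le_rfl)
  have hB0 : B ≠ 0 := by rintro rfl; exact hA (by rw [hB, mul_zero])
  have hqB : ¬ (q : ℤ) ∣ B := by
    rintro ⟨C, hC⟩
    have h : (q : ℤ) ^ (k + 1) ∣ A := ⟨C, by rw [hB, hC]; ring⟩
    rcases (padicValInt_dvd_iff (p := q) _ A).mp h with h0 | h0
    · exact hA h0
    · omega
  refine ⟨-((-1) ^ k * B), ?_, ?_, ?_⟩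
  · exact neg_ne_zero.mpr (mul_ne_zero (pow_ne_zero _ (by norm_num)) hB0)
  · intro h
    rw [dvd_neg] at h
    exact hqB ((isUnit_one.neg.pow _).dvd_mul_left.mp h)
  · have hqq : (-(q : ℤ)) ^ k * ((-1) ^ k) = (q : ℤ) ^ k := by
      rw [← mul_pow]; congr 1; ring
    rw [hB]
    linear_combination B * hqq

/-- **Ireland–Rosen's Theorem 18.7 for `E_A : y² = x³ + Ax` with the inert prime `q ∣ A` split off, at level `q · M'`.**  For a prime
`q ≡ 3 (4)`, `A ≠ 0` free of fourth powers with `q ∣ A`, a modulus `m` prime to `q` and any weight `c : ℤ/m → ℂ` with algebraic-integer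
values: there are `M'` prime to `q` and `Ψ : ℤ[i] → ℂ`, periodic modulo `M'` with algebraic-integer values, such that for `re s > 3/2`
`Σ_n c(n) a_n(E_A) n⁻ˢ = ¼ · Θ-L_{qM'}(\overline{(·/q)₄}^{v_q(A)} · Ψ)(s)` — `lSeries_twist_eq_thetaLFunction` for `D = −A = (−q)^k D₁` (level
`8|D|m`) with the coefficient split by `thetaWeight_inert_split`, re-levelled to `q M'`, `M' = 8|D₁|m` (both theta `L`-values are the
absolutely convergent sum `Σ_x Ψ_D(x) x N(x)^{-s}`, `GaussianTheta.hasSum_thetaLFunction`).  The case `q = 3`, `c = χ̄` is the BSD programme's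
`model_thetaDictionary` (crux `InertBadAtThree`); `q = 7` serves its supercuspidal twin. [cite: IrelandRosen1990, Ch. 18 §6, Theorem 7] [cite: KoblitzECMF1993, Ch. II §5] -/
theorem lSeries_twist_eq_thetaLFunction_inert {q : ℕ} (hq : q.Prime) (hq3 : q % 4 = 3) {A : ℤ} (hA : A ≠ 0)
    (hqA : (q : ℤ) ∣ A) (h4 : ∀ p : ℕ, p.Prime → ¬ ((p : ℤ) ^ 4 ∣ A)) [NeZero m] (hqm : ¬ q ∣ m)
    (c : ZMod m → ℂ) (hc : ∀ a, IsIntegral ℤ (c a)) :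
    ∃ (M' : ℕ) (_ : NeZero M') (_ : NeZero (q * M')) (Ψ : GaussianInt → ℂ),
      Nat.Coprime q M' ∧ (∀ x y : GaussianInt, Ψ (x + M' * y) = Ψ x) ∧ (∀ x : GaussianInt, IsIntegral ℤ (Ψ x)) ∧
      ∀ s : ℂ, 3 / 2 < s.re →
        LSeries (fun n : ℕ ↦ c (n : ZMod m) * ((⟨0, 0, 0, (A : ℚ), 0⟩ : WeierstrassCurve ℚ).LFunction n : ℂ)) s =
          (1 / 4 : ℂ) * GaussianTheta.thetaLFunction (q * M')
            (fun x ↦ (conj (((quarticCharMod q x : GaussianInt) : ℂ))) ^ (padicValInt q A) * Ψ x) s := by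
  haveI : Fact q.Prime := ⟨hq⟩
  set k : ℕ := padicValInt q A with hk
  have hk0 : k ≠ 0 := by
    intro h0
    rcases (padicValInt_dvd_iff (p := q) 1 A).mp (by simpa using hqA) with h | h
    · exact hA h
    · omega
  obtain ⟨D₁, hD₁0, hqD₁, hDA⟩ := exists_neg_eq_neg_pow_mul hq hA
  set D : ℤ := -A with hD
  have hD0 : D ≠ 0 := neg_ne_zero.mpr hA
  have hD4 : ∀ p : ℕ, p.Prime → ¬ ((p : ℤ) ^ 4 ∣ D) := fun p hp h ↦ h4 p hp (by rwa [hD, dvd_neg] at h)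
  have hq2 : q ≠ 2 := by rintro rfl; norm_num at hq3
  -- the modulus `M' = 8 |D₁| m`, prime to `q`
  set M' : ℕ := 8 * D₁.natAbs * m with hM'
  haveI hM'0 : NeZero M' := ⟨by rw [hM']; positivity [Int.natAbs_ne_zero.mpr hD₁0, NeZero.ne m]⟩
  haveI hqM'0 : NeZero (q * M') := ⟨mul_ne_zero hq.ne_zero (NeZero.ne M')⟩
  have hcop : Nat.Coprime q M' := by
    rw [hM']
    refine Nat.Coprime.mul_right (Nat.Coprime.mul_right ?_ ?_) ?_
    · rw [show (8 : ℕ) = 2 ^ 3 by norm_num]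
      exact Nat.Coprime.pow_right _ ((Nat.coprime_primes hq Nat.prime_two).mpr hq2)
    · exact (Nat.Prime.coprime_iff_not_dvd hq).mpr (fun h ↦ hqD₁ (Int.ofNat_dvd_left.mpr h))
    · exact (Nat.Prime.coprime_iff_not_dvd hq).mpr hqm
  -- the two theta coefficients: `Ψ_D` (level `8|D|m`) and its `q`-free part `Ψ` (level `M'`)
  set ΨD : GaussianInt → ℂ := fun x ↦
    (if IsCoprime x.norm D then ((star (quarticSymbolInt D x) * primaryUnit x : GaussianInt) : ℂ) else 0) *
      c (x.norm : ZMod m) with hΨD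
  set Ψ : GaussianInt → ℂ := fun x ↦
    (if IsCoprime x.norm D₁ then
      ((star (quarticSymbolInt D₁ x) * (star (quarticCharMod q (primaryUnit x)) ^ k * primaryUnit x) : GaussianInt) : ℂ) else 0) *
      c (x.norm : ZMod m) with hΨ
  have hΨper : ∀ x y : GaussianInt, Ψ (x + (M' : GaussianInt) * y) = Ψ x := fun x y ↦
    thetaWeight_periodic hD₁0 (fun u ↦ star (quarticCharMod q u) ^ k * u) (by simp) c (Ψ := Ψ) (fun _ ↦ rfl) x y
  have hΨint : ∀ x : GaussianInt, IsIntegral ℤ (Ψ x) := fun x ↦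
    isIntegral_thetaWeight (D := D₁) (fun u ↦ star (quarticCharMod q u) ^ k * u) hc (Ψ := Ψ) (fun _ ↦ rfl) x
  have hsplit : ∀ x : GaussianInt, ΨD x = ((star (quarticCharMod q x) : GaussianInt) : ℂ) ^ k * Ψ x := fun x ↦
    thetaWeight_inert_split (D := D) hq hq3 hk0 D₁ hDA c (Ψ := ΨD) (Ψ' := Ψ) (fun _ ↦ rfl) (fun _ ↦ rfl) x
  refine ⟨M', hM'0, hqM'0, Ψ, hcop, hΨper, hΨint, fun s hs ↦ ?_⟩
  haveI : NeZero (8 * D.natAbs * m) := ⟨by positivity [Int.natAbs_ne_zero.mpr hD0, NeZero.ne m]⟩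
  -- Ireland–Rosen 18.7 at level `8|D|m`
  have h1 : LSeries (fun n : ℕ ↦ c (n : ZMod m) * ((⟨0, 0, 0, (A : ℚ), 0⟩ : WeierstrassCurve ℚ).LFunction n : ℂ)) s =
      (1 / 4 : ℂ) * GaussianTheta.thetaLFunction (8 * D.natAbs * m) ΨD s := by
    have h := lSeries_twist_eq_thetaLFunction hD0 hD4 c (Ψ := ΨD) (fun _ ↦ rfl) hs
    have hmodel : (⟨0, 0, 0, -(D : ℚ), 0⟩ : WeierstrassCurve ℚ) = ⟨0, 0, 0, (A : ℚ), 0⟩ := by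
      rw [hD]; push_cast; ring_nf
    rw [hmodel] at h
    exact h
  -- re-levelling: both theta `L`-values are the sum `Σ_x Ψ_D(x) x N(x)^{-s}` on `re s > 3/2`
  have hΦper : ∀ x y : GaussianInt,
      (conj (((quarticCharMod q (x + (q * M' : ℕ) * y) : GaussianInt) : ℂ))) ^ k * Ψ (x + (q * M' : ℕ) * y) =
        (conj (((quarticCharMod q x : GaussianInt) : ℂ))) ^ k * Ψ x := by
    intro x y
    rw [show x + ((q * M' : ℕ) : GaussianInt) * y = x + ((q : ℤ) : GaussianInt) * ((M' : GaussianInt) * y) by push_cast; ring,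
      quarticCharMod_add_mul, show x + ((q : ℤ) : GaussianInt) * ((M' : GaussianInt) * y) = x + (M' : GaussianInt) * (q * y) by
        push_cast; ring, hΨper]
  have hsumD := GaussianTheta.hasSum_thetaLFunction (8 * D.natAbs * m) ΨD (thetaWeight_periodic hD0 id rfl c (Ψ := ΨD) (fun _ ↦ rfl)) hs
  have hsumΦ := GaussianTheta.hasSum_thetaLFunction (q * M')
    (fun x ↦ (conj (((quarticCharMod q x : GaussianInt) : ℂ))) ^ k * Ψ x) hΦper hs
  have hfun : (fun x : GaussianInt ↦ (conj (((quarticCharMod q x : GaussianInt) : ℂ))) ^ k * Ψ x * (x : ℂ) /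
      (((x.norm : ℤ) : ℂ)) ^ s) = (fun x : GaussianInt ↦ ΨD x * (x : ℂ) / (((x.norm : ℤ) : ℂ)) ^ s) := by
    funext x
    rw [hsplit x, ← GaussianInt.toComplex_star]
  rw [hfun] at hsumΦ
  rw [h1, hsumD.unique hsumΦ]

end QuarticTwist

end Literature.NumberTheory.EllipticCurves

end
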